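import Literature.NumberTheory.CubicFields.PureCubicExactTests
import Literature.NumberTheory.CubicFields.PureCubicEmbeddingMatrix
import Literature.NumberTheory.CubicFields.VoronoiReduction
import HarnessLib

/-!
# The lattice of a canonical code inside the scaled embedding: short vectors and the minimum

Topic `NumberTheory/CubicFields`, sub-namespace `PureCubicLexMin`. Let `I` be a fractional ideal of the
cubic field `K = ℚ(θ)`, `θ³ = ab²`, whose elements are exactly the values
`(u (h11, h12, h13) + v (0, h22, h23) + w (0, 0, h33)) · (1, θ, θ₂) / den` of the lattice code
`(den, [h11, …, h33])` (`PureCubicCodes.Mem`), with `h11, h22, h33 ≠ 0`, and let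
`B_X = embMatrix (t1 a b) (t2 a b) X den [h11, …, h33]`. PROVED here:

* `mem_iff_exists_coords`, `rowLin_div_mem`, `rowLin_ne_zero` : coordinates `c ∈ ℤ³` of the elements
  of `I`, and injectivity of `c ↦ c H (1, θ, θ₂)`;
* `half_le_norm_vecMul` (**short vectors**): if `γ ∈ I` is least in the open unit cylinder
  `{σ₁ > 0, ‖σ₂‖ < 1}` and `X ≤ σ₁ γ`, then every nonzero integer row has `‖c B_X‖ ≥ 1/2` (a cylinder
  element `±φ` has `|σ₁ φ| ≥ σ₁ γ ≥ X`; otherwise `‖σ₂ φ‖ ≥ 1` forces `max(|Re|, |Im|) ≥ 1/2`);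
* `norm_vecMul_coords_le_two` : the coordinate row of `γ` itself has `‖cγ B_X‖ ≤ 2` once `σ₁ γ < 2X`;
* `inv_pow_lt_sigma1` : `1/den³ < σ₁ γ` (`N γ = normRow / den³` is a nonzero integer over `den³`).

## References

* J. Buchmann, H. C. Williams, *On the infrastructure of the principal ideal class of an algebraic
  number field of unit rank one*, Math. Comp. 50 (1988). [folklore]
* H. Cohen, *A Course in Computational Algebraic Number Theory*, GTM 138 (1993), §6.5. [Cohen1993]
-/

noncomputable section

namespace Literature.NumberTheory.CubicFields

namespace PureCubicLexMin

open Matrix Literature.Algebra.EuclideanLattices PureCubicCodes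
  Literature.NumberTheory.NumberFields.PureCubic
open scoped NumberField ComplexConjugate nonZeroDivisors

section Lattice

variable {K : Type*} [Field K] [NumberField K] {a b : ℕ} {θ : K}
  (hdeg : Module.finrank ℚ K = 3) (hab : Squarefree (a * b)) (hab1 : a * b ≠ 1)
  (hθ : θ ^ 3 = ((a * b ^ 2 : ℕ) : K))
  {den : ℕ} (hden : den ≠ 0) {h11 h12 h13 h22 h23 h33 : ℤ}
  {I : FractionalIdeal (𝓞 K)⁰ K}
  (hI : ∀ φ : K, Mem θ b (den, [h11, h12, h13, h22, h23, h33]) φ ↔ φ ∈ I)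

omit [NumberField K] in
/-- The coordinate row `c H` of an integer row `c`. (Local shorthand, written out.) [folklore] -/
theorem rowLin_eq (c : Fin 3 → ℤ) :
    lin θ b (c 0 * h11, c 0 * h12 + c 1 * h22, c 0 * h13 + c 1 * h23 + c 2 * h33) =
      ((c 0 * h11 : ℤ) : K) + ((c 0 * h12 + c 1 * h22 : ℤ) : K) * θ +
        ((c 0 * h13 + c 1 * h23 + c 2 * h33 : ℤ) : K) * (θ ^ 2 / (b : K)) := rfl

omit [NumberField K] in
include hI in
/-- **Elements of `I` in coordinates**: `φ ∈ I` iff `den φ = (u, v, w) H · (1, θ, θ₂)` for integers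
`u, v, w`. [folklore] -/
theorem mem_iff_exists_coords (φ : K) :
    φ ∈ I ↔ ∃ u v w : ℤ, (den : K) * φ =
      lin θ b (u * h11, u * h12 + v * h22, u * h13 + v * h23 + w * h33) := by
  rw [← hI]
  constructor
  · rintro ⟨h11', h12', h13', h22', h23', h33', u, v, w, hl, heq⟩
    simp only [List.cons.injEq, and_true] at hl
    obtain ⟨rfl, rfl, rfl, rfl, rfl, rfl⟩ := hl
    exact ⟨u, v, w, heq⟩
  · rintro ⟨u, v, w, heq⟩
    exact ⟨h11, h12, h13, h22, h23, h33, u, v, w, rfl, heq⟩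

include hI hden in
/-- The value of a coordinate row lies in `I`. [folklore] -/
theorem rowLin_div_mem (c : Fin 3 → ℤ) :
    lin θ b (c 0 * h11, c 0 * h12 + c 1 * h22, c 0 * h13 + c 1 * h23 + c 2 * h33) / (den : K) ∈ I := by
  rw [mem_iff_exists_coords hI]
  exact ⟨c 0, c 1, c 2, by rw [mul_div_cancel₀ _ (Nat.cast_ne_zero.2 hden)]⟩

include hdeg hab hab1 hθ in
/-- **Injectivity**: a nonzero integer row has a nonzero value (`1, θ, θ₂` are independent over `ℚ`
and `H` is triangular with nonzero diagonal). [folklore] -/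
theorem rowLin_ne_zero (h11ne : h11 ≠ 0) (h22ne : h22 ≠ 0) (h33ne : h33 ≠ 0) {c : Fin 3 → ℤ} (hc : c ≠ 0) :
    lin θ b (c 0 * h11, c 0 * h12 + c 1 * h22, c 0 * h13 + c 1 * h23 + c 2 * h33) ≠ 0 := by
  intro h0
  apply hc
  have h0' : (((c 0 * h11 : ℤ) : ℚ) : K) + (((c 0 * h12 + c 1 * h22 : ℤ) : ℚ) : K) * θ +
      (((c 0 * h13 + c 1 * h23 + c 2 * h33 : ℤ) : ℚ) : K) * (θ ^ 2 / (b : K)) = 0 := by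
    simpa only [lin, Rat.cast_intCast] using h0
  obtain ⟨e1, e2, e3⟩ := coords_eq_zero hdeg hab hab1 hθ h0'
  have f1 : c 0 * h11 = 0 := by exact_mod_cast e1
  have f2 : c 0 * h12 + c 1 * h22 = 0 := by exact_mod_cast e2
  have f3 : c 0 * h13 + c 1 * h23 + c 2 * h33 = 0 := by exact_mod_cast e3
  have g0 : c 0 = 0 := (mul_eq_zero.1 f1).resolve_right h11ne
  rw [g0, zero_mul, zero_add] at f2
  have g1 : c 1 = 0 := (mul_eq_zero.1 f2).resolve_right h22ne
  rw [g0, g1, zero_mul, zero_mul, zero_add, zero_add] at f3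
  have g2 : c 2 = 0 := (mul_eq_zero.1 f3).resolve_right h33ne
  funext i
  fin_cases i <;> assumption

end Lattice

section ShortVectors

variable {K : Type*} [Field K] [NumberField K] {a b : ℕ} {θ : K} (σ₁ : K →+* ℝ) (σ₂ : K →+* ℂ)
  (hdeg : Module.finrank ℚ K = 3) (hab : Squarefree (a * b)) (hab1 : a * b ≠ 1)
  (hθ : θ ^ 3 = ((a * b ^ 2 : ℕ) : K)) (hσ₂ : ∃ z : K, conj (σ₂ z) ≠ σ₂ z)
  {den : ℕ} (hden : den ≠ 0) {h11 h12 h13 h22 h23 h33 : ℤ}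
  {I : FractionalIdeal (𝓞 K)⁰ K}
  (hI : ∀ φ : K, Mem θ b (den, [h11, h12, h13, h22, h23, h33]) φ ↔ φ ∈ I)
include hdeg hab hab1 hθ hσ₂ hden

/-- **The sup norm of `c B_X`** is `max (|σ₁ φ|/X, |Re σ₂ φ|, |Im σ₂ φ|)` for the value `φ` of the
coordinate row `c H`. [cite: Cohen1993, §6.5] -/
theorem norm_vecMul_embMatrix_eq {X : ℝ} (hX : 0 < X) (c : Fin 3 → ℤ) :
    ‖(fun i => (c i : ℝ)) ᵥ* embMatrix (t1 a b) (t2 a b) X den [h11, h12, h13, h22, h23, h33]‖ =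
      max (|σ₁ (lin θ b (c 0 * h11, c 0 * h12 + c 1 * h22, c 0 * h13 + c 1 * h23 + c 2 * h33) / (den : K))| / X)
        (max |(σ₂ (lin θ b (c 0 * h11, c 0 * h12 + c 1 * h22, c 0 * h13 + c 1 * h23 + c 2 * h33) / (den : K))).re|
          |(σ₂ (lin θ b (c 0 * h11, c 0 * h12 + c 1 * h22, c 0 * h13 + c 1 * h23 + c 2 * h33) / (den : K))).im|) := by
  rw [cast_vecMul_embMatrix]
  exact norm_embRow_eq σ₁ σ₂ hdeg hab hab1 hθ hσ₂ hX hden _ _ _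

include hI in
/-- **Short vectors of the scaled lattice**: if `γ ∈ I` has `σ₁ γ ≤ σ₁ φ` for every `φ ∈ I` in the
open unit cylinder and `X ≤ σ₁ γ`, then `‖c B_X‖ ≥ 1/2` for every nonzero integer row `c`
(`h11 h22 h33 ≠ 0`). [cite: Cohen1993, §6.5] -/
theorem half_le_norm_vecMul (h11ne : h11 ≠ 0) (h22ne : h22 ≠ 0) (h33ne : h33 ≠ 0)
    {γ : K} (hleast : ∀ φ : K, φ ∈ I → 0 < σ₁ φ → ‖σ₂ φ‖ < 1 → σ₁ γ ≤ σ₁ φ)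
    {X : ℝ} (hX : 0 < X) (hXγ : X ≤ σ₁ γ) {c : Fin 3 → ℤ} (hc : c ≠ 0) :
    1 / 2 ≤ ‖(fun i => (c i : ℝ)) ᵥ* embMatrix (t1 a b) (t2 a b) X den [h11, h12, h13, h22, h23, h33]‖ := by
  rw [norm_vecMul_embMatrix_eq σ₁ σ₂ hdeg hab hab1 hθ hσ₂ hden hX]
  set φ := lin θ b (c 0 * h11, c 0 * h12 + c 1 * h22, c 0 * h13 + c 1 * h23 + c 2 * h33) / (den : K) with hφ
  have hφI : φ ∈ I := rowLin_div_mem hden hI c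
  have hφ0 : φ ≠ 0 := div_ne_zero (rowLin_ne_zero hdeg hab hab1 hθ h11ne h22ne h33ne hc)
    (Nat.cast_ne_zero.2 hden)
  by_cases h1 : ‖σ₂ φ‖ < 1
  · -- `±φ` is in the cylinder, so `|σ₁ φ| ≥ σ₁ γ ≥ X`
    have hσ0 : σ₁ φ ≠ 0 := (map_ne_zero σ₁).2 hφ0
    have habs : σ₁ γ ≤ |σ₁ φ| := by
      rcases lt_or_gt_of_ne hσ0 with hneg | hpos
      · have h := hleast (-φ) (neg_mem_fractionalIdeal hφI) (by rw [map_neg]; linarith)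
          (by rwa [map_neg, norm_neg])
        rw [map_neg] at h
        rw [abs_of_neg hneg]; exact h
      · rw [abs_of_pos hpos]; exact hleast φ hφI hpos h1
    refine le_trans ?_ (le_max_left _ _)
    rw [le_div_iff₀ hX]
    linarith
  · -- `‖σ₂ φ‖ ≥ 1`, so one of `|Re|, |Im|` is `≥ 1/2`
    push Not at h1
    refine le_trans ?_ (le_max_right _ _)
    by_contra hcon
    push Not at hcon
    obtain ⟨hre, him⟩ := max_lt_iff.1 hcon
    have hsq : ‖σ₂ φ‖ ^ 2 = (σ₂ φ).re ^ 2 + (σ₂ φ).im ^ 2 := by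
      rw [← Complex.normSq_eq_norm_sq, Complex.normSq_apply]; ring
    have h1' : 1 ≤ ‖σ₂ φ‖ ^ 2 := by nlinarith
    have hre2 : (σ₂ φ).re ^ 2 < 1 / 4 := by
      have := abs_lt.1 hre; nlinarith
    have him2 : (σ₂ φ).im ^ 2 < 1 / 4 := by
      have := abs_lt.1 him; nlinarith
    linarith

/-- **The coordinate row of the minimum is short**: if `den γ = cγ H · (1, θ, θ₂)`, `σ₁ γ < 2X`,
`0 < σ₁ γ` and `‖σ₂ γ‖ < 1` then `‖cγ B_X‖ ≤ 2`. [cite: Cohen1993, §6.5] -/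
theorem norm_vecMul_coords_le_two {γ : K} {cγ : Fin 3 → ℤ}
    (hcγ : (den : K) * γ = lin θ b (cγ 0 * h11, cγ 0 * h12 + cγ 1 * h22, cγ 0 * h13 + cγ 1 * h23 + cγ 2 * h33))
    (hpos : 0 < σ₁ γ) (h1 : ‖σ₂ γ‖ < 1) {X : ℝ} (hX : 0 < X) (h2X : σ₁ γ < 2 * X) :
    ‖(fun i => (cγ i : ℝ)) ᵥ* embMatrix (t1 a b) (t2 a b) X den [h11, h12, h13, h22, h23, h33]‖ ≤ 2 := by
  rw [norm_vecMul_embMatrix_eq σ₁ σ₂ hdeg hab hab1 hθ hσ₂ hden hX]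
  have hγ : lin θ b (cγ 0 * h11, cγ 0 * h12 + cγ 1 * h22, cγ 0 * h13 + cγ 1 * h23 + cγ 2 * h33) / (den : K) = γ := by
    rw [← hcγ, mul_div_cancel_left₀ _ (Nat.cast_ne_zero.2 hden)]
  rw [hγ]
  refine max_le ?_ (max_le ?_ ?_)
  · rw [div_le_iff₀ hX, abs_of_pos hpos]; linarith
  · exact ((Complex.abs_re_le_norm _).trans h1.le).trans (by norm_num)
  · exact ((Complex.abs_im_le_norm _).trans h1.le).trans (by norm_num)

/-- **A lower bound for the real conjugate of a cylinder element**: if `den γ = cγ H · (1, θ, θ₂)`,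
`γ ≠ 0` (`0 < σ₁ γ`) and `‖σ₂ γ‖ < 1` then `1 / den³ < σ₁ γ`, because `N γ = normRow / den³` is a
nonzero integer over `den³` and `|N γ| = σ₁ γ ‖σ₂ γ‖² < σ₁ γ`. [cite: Cohen1993, §6.5] -/
theorem inv_pow_lt_sigma1 {γ : K} {cγ : Fin 3 → ℤ}
    (hcγ : (den : K) * γ = lin θ b (cγ 0 * h11, cγ 0 * h12 + cγ 1 * h22, cγ 0 * h13 + cγ 1 * h23 + cγ 2 * h33))
    (hpos : 0 < σ₁ γ) (h1 : ‖σ₂ γ‖ < 1) : 1 / (den : ℝ) ^ 3 < σ₁ γ := by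
  set w : Row := (cγ 0 * h11, cγ 0 * h12 + cγ 1 * h22, cγ 0 * h13 + cγ 1 * h23 + cγ 2 * h33) with hw
  have hγ : lin θ b w / (den : K) = γ := by
    rw [← hcγ, mul_div_cancel_left₀ _ (Nat.cast_ne_zero.2 hden)]
  have hγ0 : γ ≠ 0 := fun h => by rw [h, map_zero] at hpos; exact lt_irrefl _ hpos
  have hN := norm_lin_div hdeg hab hab1 hθ w den hden
  rw [hγ] at hN
  have hNne : Algebra.norm ℚ γ ≠ 0 := Algebra.norm_ne_zero_iff.2 hγ0
  have hnr : normRow a b w ≠ 0 := by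
    intro h0; apply hNne; rw [hN, h0]; simp
  have hdR : (0 : ℝ) < (den : ℝ) ^ 3 := by positivity
  -- `|N γ| ≥ 1 / den³`
  have habs : 1 / (den : ℝ) ^ 3 ≤ |((Algebra.norm ℚ γ : ℚ) : ℝ)| := by
    rw [hN, Rat.cast_div, Rat.cast_intCast, Rat.cast_pow, Rat.cast_natCast, abs_div,
      abs_of_pos hdR]
    refine div_le_div_of_nonneg_right ?_ hdR.le
    have : (1 : ℤ) ≤ |normRow a b w| := Int.one_le_abs hnr
    exact_mod_cast this
  -- `|N γ| = σ₁ γ ‖σ₂ γ‖² < σ₁ γ`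
  rw [norm_eq_mul_norm_sq σ₁ σ₂ hdeg hσ₂ γ, abs_mul, abs_of_pos hpos, abs_of_nonneg (sq_nonneg _)] at habs
  have h2 : ‖σ₂ γ‖ ^ 2 < 1 := by
    rw [pow_lt_one_iff_of_nonneg (norm_nonneg _) two_ne_zero]; exact h1
  calc 1 / (den : ℝ) ^ 3 ≤ σ₁ γ * ‖σ₂ γ‖ ^ 2 := habs
    _ < σ₁ γ * 1 := mul_lt_mul_of_pos_left h2 hpos
    _ = σ₁ γ := mul_one _

end ShortVectors

end PureCubicLexMin

end Literature.NumberTheory.CubicFields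

end
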